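/-
Copyright (c) 2026 the pub-hodgecm-mathlib formalisation cell (harness21).  Prover seat hodgecm-mathlib-K2E3-p14 (g10) (E3 hand on strike line L1; LEAD F0P6-plan (g15)
BATCH #246 (i)), Track B «K2-LIT» ∕ hLiu418 = `stmt-HodgeConjecture-24832`: U1-glob LEVEL 2-fin, the ARCH-KERNEL branch — the by-name payer of the arch READING letter (α)
`(Ainfc, hAinfc, hAinf)` of ★ (F-arch) p863937 `archCornerPackage_cm` ∕ ★ (F-tail-arch) FILE 4 p864223 `hloc`, at SCALAR `K_w`-type, from ★ p864260 (transport + Fubini through the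
tube frame) and ★ `K2LiuArchTwistedKTypeBlockContinuation` (C131-p02, per-place continuation).  THEOREMS ONLY (no `def` ∕ `instance` ∕ notation ∕ named-fact hypothesis ∕ `sorry`).
-/
import Summits.HodgeConjecture.HodgeConjecture.Theorems.K2LiuIncoherentRankOneArchPlaceTensor     -- ★ p864260 (LH4-p17): `integral_eq_mul_prod_of_frameTensor` (+ the K2_Liu frame vocabulary)
import Summits.HodgeConjecture.HodgeConjecture.Theorems.K2LiuArchTwistedKTypeBlockContinuation     -- ★ (C131-p02): `exists_archLetters_scalarType`, `exists_archLetters_scalarType_neg` (over ★ p863260)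
import Summits.HodgeConjecture.HodgeConjecture.Theorems.K2LiuSiegelUnipotentLocalDefs              -- `unipDeltaArch`
import HarnessLib

/-!
# Crux `HLiu418`, U1-glob LEVEL 2-fin, arch-kernel branch — `K2LiuLocalKernelArchReadingScalarType`: THE ARCH BLOCK OF THE CORNER TERM, CONTINUED, AT SCALAR `K_w`-TYPE
# `∫_{N_Δ(L⁺⊗ℝ)} conj ψ_S(u_∞)·bA_s((w_Δ)_∞ u h_∞) dν_∞ = c · ∏_{w complex} E_w(s)` on `{½ < re s}`, every `E_w` holomorphic on `{0 < re s}`   [KudlaRallis1994 §2; Shimura1982 §4; Tan1999 §3]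

Cell `hodgecm-mathlib`, crux item hLiu418 = `stmt-HodgeConjecture-24832`; squad K2, strike line L1, LEAD F0P6-plan (g15) BATCH #246 (i); U1 desk K2E3-p28 (g4); END pen
K2E3-p32 (g3) (FILE B-arch `K2LiuLocalKernelResidueVanishesArch`).  Lane `--supports stmt-HodgeConjecture-24832 --as helper` (count-neutral).  THEOREMS ONLY.

THE POINT.  ★ (F-arch) `archCornerPackage_cm` takes the arch block of the corner-twisted singular term at the point, `A∞ s = ∫ conj ψ_S(u_∞)·bA_s((w_Δ)_∞ u h_∞) dν_∞(u)` (★ FILE 4's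
`hloc` with `Fn := A∞`), together with a CONTINUATION `A∞c` holomorphic on `{0 < re}` agreeing with `A∞` on `{1 < re}` — the letter (α), BY VALUE there.  At SCALAR `K_w`-TYPE this
file pays it from two ★ facts and ONE presentation letter:
(T+F) ★ p864260 §1 `K2LiuIncoherentRankOneArchPlaceTensor.integral_eq_mul_prod_of_frameTensor` — Haar transport of `ν_∞` through the tube frame (`htrans`, ★ K2Liu-p11
`exists_integral_frame_eq_smul`'s shape: `∫ Ψ(Fr u) dν = c • ∫_{∏_w ℝ^{2×2}} Ψ((nfr w r_w)_w) dr`) + Fubini over the finite product of the complex places: for an integrand that is a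
PURE TENSOR through the frame (`hpure : F s u = ∏_w Ψloc w s (Fr u w)`), `∫ F_s dν = c · ∏_w ∫ Ψloc w s (nfr w ρ) dρ`;
(C) ★ `K2LiuArchTwistedKTypeBlockContinuation.exists_archLetters_scalarType{,_neg}` (C131-p02, over ★ p863260): the local block at the complex place `w` READ at scalar type `k_w`
with a rank-one index of either sign, `∫ e(−τ(T_w·hermOfReal ρ)) · f⁰_{s,k_w}(J·n(hermOfReal ρ)·hfr_w) dρ` (`T_w = ±a_w·hermTwo(t_w,0,0)·a_wᴴ`, `‖det a_w‖ = 1`, `t_w > 0`,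
`hfr_w ∈ U(J)`), has a continuation `E_w` holomorphic on `{0 < re s}`, equal to it on `{½ < re s}`;
(P) the SCALAR-TYPE FRAME READING of the local integrands (`hΨ`), BY VALUE — the same letter as ★ p864260's `hpure` (payer: the (o1)∕(Φ-S1) arch presentation lineage).
THEN `A∞c s := c · ∏_w E_w(s)` is holomorphic on `{0 < re}` and equals the block on `{½ < re} ⊇ {1 < re}` — with the per-place WITNESS exported, so that the (σ-A)∕U1-glob(σ)
letter kills `A∞c ½` from ONE dead factor `E_{w₀}(½) = 0` (★ p863937 §2(a) `archBlock_eq_zero_of_placeFactors`, readings (b)∕(c) there).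
* §1 GENERIC **`exists_continuation_of_frameTensor_scalarType`** (any measure space `Ω`, any finite place-index type `σ`, any frame target `Mfr`).
* §2 AT THE K2_Liu FRAME **`hloc_archLetters_of_scalarType`** — `Ω := N_Δ(L⁺⊗ℝ)`, `σ := {w ∣ complex}`, `F s u := conj ψ_S(u_∞)·bA_s((w_Δ)_∞ u h_∞)` (★ FILE 4's `hloc` integrand
  TOKEN FOR TOKEN) ⊢ (F-arch)'s `(Ainfc, hAinfc, hAinf)` + the per-place witness.
References: [KudlaRallis1994] §2 (2.10)–(2.12); [Shimura1982] §4 Thm. 4.2; [Tan1999] §3; [Tate1967] §3 Thm. 3.3.1; [Folland1995] §2.2; [BorelJacquet1979] §4.1.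
HONEST LABEL.  Count-neutral composition: `HC_CM` is proved only modulo the 7 printed citations (2 remaining named inputs: hLiu418 = `stmt-HodgeConjecture-24832`,
h413 = `stmt-HodgeConjecture-24833`) until rung 0 closes; U1-glob LEVEL 2 stays OPEN (FILE B-arch; `htrans` by name at the tie; (P) by value; `hdead∞` = (σ-A)).
-/

set_option autoImplicit false
set_option linter.dupNamespace false -- the mandated namespace repeats `HodgeConjecture.HodgeConjecture`

noncomputable section

open scoped Matrix NNReal ComplexOrder ComplexConjugate
open Complex MeasureTheory Matrix NumberField NumberField.InfinitePlace IsDedekindDomain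
open Literature.NumberTheory.Automorphic Literature.NumberTheory.Automorphic.UnitaryGroup Literature.NumberTheory.GaloisRepresentations
open Literature.NumberTheory.GelbartRogawski1991 Literature.NumberTheory.GelbartRogawski1991.GRConstruction
open Literature.NumberTheory.K2Lit.SiegelDoubled

namespace Summit.HodgeConjecture.HodgeConjecture.Cruxes.HLiu418.K2LiuLocalKernelArchReadingScalarType

open K2LiuSiegelUnipotentFourierDefs
open K2LiuSiegelUnipotentLocalDefs
open K2LiuHermTwoGammaDefs
open K2LiuArchInducedTubeDefs
open K2LiuIncoherentRankOneArchPlaceTensor (integral_eq_mul_prod_of_frameTensor)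
open K2LiuArchTwistedKTypeBlockContinuation (exists_archLetters_scalarType exists_archLetters_scalarType_neg)

/-! ## §1 Generic: a frame-tensor family whose local factors are scalar-type rank-one blocks continues to `{0 < re s}` -/

/-- **CONTINUATION OF A FRAME-TENSOR FAMILY AT SCALAR TYPE (generic).**  A measure `ν` on `Ω`, a frame `Fr : Ω → σ → Mfr` with local coordinates `nfr w : ℝ^{2×2} → Mfr` and the
TRANSPORT letter `htrans` (★ `exists_integral_frame_eq_smul`'s shape); an `s`-family of integrands that is a PURE TENSOR through the frame (`hpure`); and per place `w` the SCALAR-TYPE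
READING of the local integrand in coordinates (`hΨ`: character of a rank-one index `T_w = ±a_w·hermTwo(t_w,0,0)·a_wᴴ` of either sign, `‖det a_w‖ = 1`, `t_w > 0`, times the scalar-type
section `f⁰_{s,k_w}` at `J·n(hermOfReal ρ)·hfr_w`, `hfr_w ∈ U(J)`).  THEN there are `E_w` holomorphic on `{0 < re s}`, equal to the local blocks on `{½ < re s}`, such that
`∫ F_s dν = c · ∏_w E_w(s)` on `{½ < re s}`, the right side holomorphic on `{0 < re s}`. [cite: KudlaRallis1994, §2 (2.10)–(2.12)] [cite: Shimura1982, §4 Thm. 4.2]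
[cite: Tate1967, §3 Thm. 3.3.1] [cite: Folland1995, §2.2] -/
theorem exists_continuation_of_frameTensor_scalarType {Ω σ Mfr : Type*} [MeasurableSpace Ω] (ν : Measure Ω) [Fintype σ]
    (Fr : Ω → σ → Mfr) (nfr : σ → (Fin 2 → Fin 2 → ℝ) → Mfr) (c : ℝ≥0)
    (htrans : ∀ Ψ : (σ → Mfr) → ℂ, ∫ u, Ψ (Fr u) ∂ν = c • ∫ r : σ → (Fin 2 → Fin 2 → ℝ), Ψ (fun w => nfr w (r w)))
    (F : ℂ → Ω → ℂ) (Ψloc : σ → ℂ → Mfr → ℂ) (hpure : ∀ (s : ℂ) (u : Ω), F s u = ∏ w, Ψloc w s (Fr u w))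
    -- per place: the scalar-type reading of the local integrand (BY VALUE)
    (k : σ → ℤ) (a : σ → Matrix (Fin 2) (Fin 2) ℂ) (hdet : ∀ w, ‖(a w).det‖ = 1) (t : σ → ℝ) (ht : ∀ w, 0 < t w)
    (Tidx : σ → Matrix (Fin 2) (Fin 2) ℂ) (hT : ∀ w, Tidx w = a w * hermTwo (t w, 0, 0) * (a w)ᴴ ∨ Tidx w = -(a w * hermTwo (t w, 0, 0) * (a w)ᴴ))
    (hfr : σ → Matrix (Fin 2 ⊕ Fin 2) (Fin 2 ⊕ Fin 2) ℂ) (hhfr : ∀ w, (hfr w)ᴴ * Matrix.J (Fin 2) ℂ * hfr w = Matrix.J (Fin 2) ℂ)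
    (hΨ : ∀ (w : σ) (s : ℂ) (ρ : Fin 2 → Fin 2 → ℝ), Ψloc w s (nfr w ρ) =
      cexp (-(2 * Real.pi * I) * (Tidx w * hermOfReal ρ).trace) * archScalarSection (k w) s (Matrix.J (Fin 2) ℂ * fromBlocks 1 (hermOfReal ρ) 0 1 * hfr w)) :
    ∃ E : σ → ℂ → ℂ,
      (∀ w, DifferentiableOn ℂ (E w) {s : ℂ | 0 < s.re}) ∧
      (∀ (w : σ) (s : ℂ), 1 / 2 < s.re →
        (∫ ρ : Fin 2 → Fin 2 → ℝ, cexp (-(2 * Real.pi * I) * (Tidx w * hermOfReal ρ).trace) *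
          archScalarSection (k w) s (Matrix.J (Fin 2) ℂ * fromBlocks 1 (hermOfReal ρ) 0 1 * hfr w)) = E w s) ∧
      (∀ (w : σ) (s : ℂ), 1 / 2 < s.re → ∫ ρ : Fin 2 → Fin 2 → ℝ, Ψloc w s (nfr w ρ) = E w s) ∧
      DifferentiableOn ℂ (fun s => ((c : ℝ) : ℂ) * ∏ w, E w s) {s : ℂ | 0 < s.re} ∧
      ∀ s : ℂ, 1 / 2 < s.re → ∫ u, F s u ∂ν = ((c : ℝ) : ℂ) * ∏ w, E w s := by
  -- (C) per place, by cases on the sign of the rank-one index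
  have key : ∀ w : σ, ∃ Ew : ℂ → ℂ, DifferentiableOn ℂ Ew {s : ℂ | 0 < s.re} ∧ ∀ s : ℂ, 1 / 2 < s.re →
      (∫ ρ : Fin 2 → Fin 2 → ℝ, cexp (-(2 * Real.pi * I) * (Tidx w * hermOfReal ρ).trace) *
          archScalarSection (k w) s (Matrix.J (Fin 2) ℂ * fromBlocks 1 (hermOfReal ρ) 0 1 * hfr w)) = Ew s := by
    intro w
    rcases hT w with hpos | hneg
    · obtain ⟨N, hN⟩ := exists_nat_gt (((k w : ℤ) : ℝ) / 2)
      obtain ⟨Ac, hAcd, hAceq⟩ := exists_archLetters_scalarType (k w) (hdet w) (ht w) hN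
      refine ⟨fun s => Ac s (hfr w), hAcd _ (hhfr w), fun s hs => ?_⟩
      rw [hpos]
      exact hAceq s hs _ (hhfr w)
    · obtain ⟨N, hN⟩ := exists_nat_gt (-((k w : ℤ) : ℝ) / 2)
      obtain ⟨Ac, hAcd, hAceq⟩ := exists_archLetters_scalarType_neg (k w) (hdet w) (ht w) hN
      refine ⟨fun s => Ac s (hfr w), hAcd _ (hhfr w), fun s hs => ?_⟩
      rw [hneg]
      exact hAceq s hs _ (hhfr w)
  choose E hEd hEeq using key
  have hEeq' : ∀ (w : σ) (s : ℂ), 1 / 2 < s.re → ∫ ρ : Fin 2 → Fin 2 → ℝ, Ψloc w s (nfr w ρ) = E w s := fun w s hs => by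
    rw [← hEeq w s hs]
    exact integral_congr_ae (Filter.Eventually.of_forall fun ρ => hΨ w s ρ)
  refine ⟨E, hEd, hEeq, hEeq', (differentiableOn_const _).mul (DifferentiableOn.fun_finsetProd fun w _ => hEd w), fun s hs => ?_⟩
  -- (T+F) ★ p864260 §1, then the local blocks replaced by their continuations
  rw [integral_eq_mul_prod_of_frameTensor ν Fr nfr c htrans (fun w m => Ψloc w s m) (hpure s)]
  exact congrArg _ (Finset.prod_congr rfl fun w _ => hEeq' w s hs)

/-! ## §2 At the K2_Liu frame: (F-arch)'s arch reading letter `(Ainfc, hAinfc, hAinf)` with the per-place witness -/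

section Frame

variable (L : Type) [Field L] [NumberField L] [IsCMField L]
variable {N M n : ℕ} (e : Fin N × Fin M ≃ Fin n)
  (dV : Fin N → L) (hdV : ∀ i, IsCMField.complexConj L (dV i) = dV i)
  (dW : Fin M → L) (hdW : ∀ i, IsCMField.complexConj L (dW i) = dW i)

/-- **(α) THE ARCH READING AT SCALAR `K_w`-TYPE — `(Ainfc, hAinfc, hAinf)` of ★ `archCornerPackage_cm` for the block `A∞ s = ∫ conj ψ_S(u_∞)·bA_s((w_Δ)_∞ u h_∞) dν_∞` of ★ FILE 4's
`hloc`.**  BY VALUE: the transport letter `htrans` through a frame `(Fr, nfr, c)` (★ `exists_integral_frame_eq_smul` at `ν_∞`), the pure-tensor presentation `hpure` of the integrand through the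
frame and the scalar-type coordinate reading `hΨ` of its local factors (rank-one indices `T_w` of either sign, types `k_w`, model points `hfr_w ∈ U(J)`).  THEN `∃ Ainfc` holomorphic on
`{0 < re}` with `A∞ s = Ainfc s` on `{1 < re}`, and the WITNESS `Ainfc = c · ∏_w E_w` with every `E_w` holomorphic on `{0 < re}` and equal to the local block on `{½ < re}`.
[cite: KudlaRallis1994, §2 (2.10)–(2.12)] [cite: Shimura1982, §4 Thm. 4.2] [cite: Tate1967, §3 Thm. 3.3.1] [cite: BorelJacquet1979, §4.1] -/
theorem hloc_archLetters_of_scalarType [Fintype {w : InfinitePlace L // w.IsComplex}] [MeasurableSpace ↥(unipDeltaArch L e dV hdV dW hdW)]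
    (νinf : Measure ↥(unipDeltaArch L e dV hdV dW hdW)) (S : Matrix (Fin n) (Fin n) L) (h : HA L e dV hdV dW hdW) (bA : ℂ → UnitaryGroup.arch (Fp L) L (IsCMField.complexConj L) (n + n) (hermD L e dV hdV dW hdW) → ℂ)
    -- the transport through a frame (BY VALUE; ★ `exists_integral_frame_eq_smul` at `ν_∞`)
    {Mfr : Type*} (Fr : ↥(unipDeltaArch L e dV hdV dW hdW) → {w : InfinitePlace L // w.IsComplex} → Mfr) (nfr : {w : InfinitePlace L // w.IsComplex} → (Fin 2 → Fin 2 → ℝ) → Mfr) (c : ℝ≥0)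
    (htrans : ∀ Ψ : ({w : InfinitePlace L // w.IsComplex} → Mfr) → ℂ, ∫ u, Ψ (Fr u) ∂νinf = c • ∫ r : {w : InfinitePlace L // w.IsComplex} → (Fin 2 → Fin 2 → ℝ), Ψ (fun w => nfr w (r w)))
    -- the pure-tensor presentation of ★ FILE 4's `hloc` integrand through the frame (BY VALUE)
    (Ψloc : {w : InfinitePlace L // w.IsComplex} → ℂ → Mfr → ℂ)
    (hpure : ∀ (s : ℂ) (u : ↥(unipDeltaArch L e dV hdV dW hdW)),
      conj (unipDeltaChar L e dV hdV dW hdW S (UnitaryGroup.archToAdelic (Fp L) L (IsCMField.complexConj L) (n + n) (hermD L e dV hdV dW hdW) (u : UnitaryGroup.arch (Fp L) L (IsCMField.complexConj L) (n + n) (hermD L e dV hdV dW hdW))) : ℂ) *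
          bA s (UnitaryGroup.archPart (Fp L) L (IsCMField.complexConj L) (n + n) (hermD L e dV hdV dW hdW) (weylDelta L e dV hdV dW hdW) * (u : UnitaryGroup.arch (Fp L) L (IsCMField.complexConj L) (n + n) (hermD L e dV hdV dW hdW)) * UnitaryGroup.archPart (Fp L) L (IsCMField.complexConj L) (n + n) (hermD L e dV hdV dW hdW) h) =
        ∏ w, Ψloc w s (Fr u w))
    -- per complex place: the scalar-type coordinate reading (BY VALUE)
    (k : {w : InfinitePlace L // w.IsComplex} → ℤ) (a : {w : InfinitePlace L // w.IsComplex} → Matrix (Fin 2) (Fin 2) ℂ) (hdet : ∀ w, ‖(a w).det‖ = 1) (t : {w : InfinitePlace L // w.IsComplex} → ℝ) (ht : ∀ w, 0 < t w)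
    (Tidx : {w : InfinitePlace L // w.IsComplex} → Matrix (Fin 2) (Fin 2) ℂ) (hT : ∀ w, Tidx w = a w * hermTwo (t w, 0, 0) * (a w)ᴴ ∨ Tidx w = -(a w * hermTwo (t w, 0, 0) * (a w)ᴴ))
    (hfr : {w : InfinitePlace L // w.IsComplex} → Matrix (Fin 2 ⊕ Fin 2) (Fin 2 ⊕ Fin 2) ℂ) (hhfr : ∀ w, (hfr w)ᴴ * Matrix.J (Fin 2) ℂ * hfr w = Matrix.J (Fin 2) ℂ)
    (hΨ : ∀ (w : {w : InfinitePlace L // w.IsComplex}) (s : ℂ) (ρ : Fin 2 → Fin 2 → ℝ), Ψloc w s (nfr w ρ) =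
      cexp (-(2 * Real.pi * I) * (Tidx w * hermOfReal ρ).trace) * archScalarSection (k w) s (Matrix.J (Fin 2) ℂ * fromBlocks 1 (hermOfReal ρ) 0 1 * hfr w)) :
    ∃ Ainfc : ℂ → ℂ, DifferentiableOn ℂ Ainfc {s : ℂ | 0 < s.re} ∧
      (∀ s : ℂ, 1 < s.re →
        (∫ u, conj (unipDeltaChar L e dV hdV dW hdW S (UnitaryGroup.archToAdelic (Fp L) L (IsCMField.complexConj L) (n + n) (hermD L e dV hdV dW hdW) (u : UnitaryGroup.arch (Fp L) L (IsCMField.complexConj L) (n + n) (hermD L e dV hdV dW hdW))) : ℂ) *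
            bA s (UnitaryGroup.archPart (Fp L) L (IsCMField.complexConj L) (n + n) (hermD L e dV hdV dW hdW) (weylDelta L e dV hdV dW hdW) * (u : UnitaryGroup.arch (Fp L) L (IsCMField.complexConj L) (n + n) (hermD L e dV hdV dW hdW)) * UnitaryGroup.archPart (Fp L) L (IsCMField.complexConj L) (n + n) (hermD L e dV hdV dW hdW) h) ∂νinf) = Ainfc s) ∧
      ∃ E : {w : InfinitePlace L // w.IsComplex} → ℂ → ℂ,
        (∀ w, DifferentiableOn ℂ (E w) {s : ℂ | 0 < s.re}) ∧
        (∀ (w : {w : InfinitePlace L // w.IsComplex}) (s : ℂ), 1 / 2 < s.re →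
          (∫ ρ : Fin 2 → Fin 2 → ℝ, cexp (-(2 * Real.pi * I) * (Tidx w * hermOfReal ρ).trace) *
          archScalarSection (k w) s (Matrix.J (Fin 2) ℂ * fromBlocks 1 (hermOfReal ρ) 0 1 * hfr w)) = E w s) ∧
        ∀ s : ℂ, Ainfc s = ((c : ℝ) : ℂ) * ∏ w, E w s := by
  obtain ⟨E, hEd, hEeq, -, hdiff, hval⟩ := exists_continuation_of_frameTensor_scalarType νinf Fr nfr c htrans
    (fun s u => conj (unipDeltaChar L e dV hdV dW hdW S (UnitaryGroup.archToAdelic (Fp L) L (IsCMField.complexConj L) (n + n) (hermD L e dV hdV dW hdW) (u : UnitaryGroup.arch (Fp L) L (IsCMField.complexConj L) (n + n) (hermD L e dV hdV dW hdW))) : ℂ) *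
      bA s (UnitaryGroup.archPart (Fp L) L (IsCMField.complexConj L) (n + n) (hermD L e dV hdV dW hdW) (weylDelta L e dV hdV dW hdW) * (u : UnitaryGroup.arch (Fp L) L (IsCMField.complexConj L) (n + n) (hermD L e dV hdV dW hdW)) * UnitaryGroup.archPart (Fp L) L (IsCMField.complexConj L) (n + n) (hermD L e dV hdV dW hdW) h))
    Ψloc hpure k a hdet t ht Tidx hT hfr hhfr hΨ
  exact ⟨fun s => ((c : ℝ) : ℂ) * ∏ w, E w s, hdiff, fun s hs => hval s (by linarith), E, hEd, hEeq, fun s => rfl⟩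

end Frame

end Summit.HodgeConjecture.HodgeConjecture.Cruxes.HLiu418.K2LiuLocalKernelArchReadingScalarType

end
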